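import Summits.PneNP.PneNP.Theorems.NegLimitedHalfWindowSlicesVerifier
import Mathlib
import HarnessLib

/-!
# Half window — stub S′, part 2: the verifier is polynomial time; the language and `NP`
(cell pnp-ideate, rung F-N1/p3, ROUND-13; line `half-window` on item stmt-PneNP-19888, stub S′
`HalfSlicesNP`; card HOME/pnp-ideate-p3/r13/half-window.md)

Continuing `NegLimitedHalfWindowSlicesVerifier.lean` (the verdict `HalfSlices.verdict` and `codeFP_checks`):
* `codeFP_blockBit'`: the door's block bit `SlicesNP.blockBit` (p478375) read through THIS certificate format
  (`pT`, `pN`, `pK`) is polynomial time (same typed-`CodeFP` derivation as the door's `codeFP_blockBit`);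
* `codeFP_levStr`, `codeFP_rmVal` (the door's `codeFP_round` folded `d` times, the accumulator only
  shrinks), `codeFP_tribesVal` (`any`/`all` with a context), `codeFP_verdict`;
* the language `halfLang` (certificate budget `20·|u| + 20`) and `halfLang_mem_NP` (certificate definition
  of `NP`, `Nondeterministic.mem_NP_iff_verifier`).

References: S. Arora, B. Barak, *Computational Complexity* (2009), §1.3 (closure of polynomial time under
composition and bounded loops), §2.1 Def. 2.1 (certificate definition of `NP`) [AroraBarakCC2009].

HONEST FRAMING: verifier plumbing for stub S′ of an OPEN line; FRONTIER rung F-N1 — nothing here bears on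
P vs NP.
-/

set_option linter.dupNamespace false -- `Summit.PneNP.PneNP.…`: summit = sub-problem name (D-0017 single-conjunct layout)

namespace Summit.PneNP.PneNP.Theorems.NegLimitedHalfWindow.HalfSlices

open Literature.Computability.Complexity Literature.Computability.Complexity.Brick
  Literature.Computability.Complexity.CodeFP _root_.Computability Polynomial
open Summit.PneNP.PneNP.Theorems.NegLimitedAmplifiedWindow.SlicesNP
  (blockBit markCount pairOK rounds round codeFP_round length_foldl_round_le)

/-! ### The block bit through this certificate format -/

/-- The block bit is polynomial time (context `(u, y)`, item `β`; the door's derivation with the accessors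
`pT`, `pN`, `pK` of this certificate format). -/
theorem codeFP_blockBit' :
    CodeFP (pairE E natE) bitE (fun q => blockBit q.1.1 (pT q.1.2) (pN q.1.2) (pK q.1.2) q.2) := by
  -- accessors at context depth `(ε, β)`
  have hε : CodeFP (pairE E natE) E Prod.fst := fst _ _
  have hw : CodeFP (pairE E natE) natE Prod.snd := snd _ _
  have hy : CodeFP (pairE E natE) strE (fun q => q.1.2) := hε.snd'
  have hn : CodeFP (pairE E natE) natE (fun q => pN q.1.2) := (codeFP_fieldU 0).comp hy
  have hnU : CodeFP (pairE E natE) unE (fun q => pN q.1.2) := (codeFP_fieldUu 0).comp hy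
  have hT : CodeFP (pairE E natE) strE (fun q => pT q.1.2) := codeFP_pT.comp hy
  have hrange : CodeFP (pairE E natE) (rawE natE) (fun q => List.range (pN q.1.2)) := urange.comp hnU
  -- the count, item `v`
  have hind : CodeFP (pairE (pairE E natE) natE) natE
      (fun r => if (pT r.1.1.2).getD (r.1.2 * pN r.1.1.2 + r.2) false then 1 else 0) :=
    (strGetDNat.comp ((hT.comp (fst _ _)).pair (natAdd.comp ((natMul.comp ((hw.comp (fst _ _)).pair
      (hn.comp (fst _ _)))).pair (snd _ _))))).ite (const _ 1) (const _ 0)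
  have hcount : CodeFP (pairE E natE) natE (fun q => markCount (pT q.1.2) (pN q.1.2) q.2) :=
    (natSum.comp ((map hind).comp ((CodeFP.id _).pair hrange))).congr fun _ => rfl
  -- the pair test, item `ab`
  have hu' : CodeFP (pairE (pairE E natE) (pairE natE natE)) strE (fun r => r.1.1.1) := (fst _ _).fst'.fst'
  have hT' : CodeFP (pairE (pairE E natE) (pairE natE natE)) strE (fun r => pT r.1.1.2) := hT.comp (fst _ _)
  have hn' : CodeFP (pairE (pairE E natE) (pairE natE natE)) natE (fun r => pN r.1.1.2) := hn.comp (fst _ _)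
  have hw' : CodeFP (pairE (pairE E natE) (pairE natE natE)) natE (fun r => r.1.2) := (fst _ _).snd'
  have ha : CodeFP (pairE (pairE E natE) (pairE natE natE)) natE (fun r => r.2.1) := (snd _ _).fst'
  have hb : CodeFP (pairE (pairE E natE) (pairE natE natE)) natE (fun r => r.2.2) := (snd _ _).snd'
  have hwn : CodeFP (pairE (pairE E natE) (pairE natE natE)) natE (fun r => r.1.2 * pN r.1.1.2) :=
    natMul.comp (hw'.pair hn')
  have hTa : CodeFP (pairE (pairE E natE) (pairE natE natE)) bitE
      (fun r => (pT r.1.1.2).getD (r.1.2 * pN r.1.1.2 + r.2.1) false) :=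
    strGetDNat.comp (hT'.pair (natAdd.comp (hwn.pair ha)))
  have hTb : CodeFP (pairE (pairE E natE) (pairE natE natE)) bitE
      (fun r => (pT r.1.1.2).getD (r.1.2 * pN r.1.1.2 + r.2.2) false) :=
    strGetDNat.comp (hT'.pair (natAdd.comp (hwn.pair hb)))
  have hub : CodeFP (pairE (pairE E natE) (pairE natE natE)) bitE
      (fun r => r.1.1.1.getD (r.1.2 * (pN r.1.1.2 * pN r.1.1.2) + (r.2.2 + pN r.1.1.2 * r.2.1)) false) :=
    strGetDNat.comp (hu'.pair (natAdd.comp ((natMul.comp (hw'.pair (natMul.comp (hn'.pair hn')))).pair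
      (natAdd.comp (hb.pair (natMul.comp (hn'.pair ha)))))))
  have hpair : CodeFP (pairE (pairE E natE) (pairE natE natE)) bitE
      (fun r => pairOK r.1.1.1 (pT r.1.1.2) (pN r.1.1.2) r.1.2 r.2) :=
    ((natLt.comp (ha.pair hb)).not.or (hTa.not.or (hTb.not.or hub))).congr fun _ => rfl
  have hpairs : CodeFP (pairE E natE) (rawE (pairE natE natE))
      (fun q => (List.range (pN q.1.2)).product (List.range (pN q.1.2))) :=
    (rawProduct natE natE).comp (hrange.pair hrange)
  have hall : CodeFP (pairE E natE) bitE
      (fun q => ((List.range (pN q.1.2)).product (List.range (pN q.1.2))).all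
        (pairOK q.1.1 (pT q.1.2) (pN q.1.2) q.2)) :=
    ((all hpair).comp ((CodeFP.id _).pair hpairs)).congr fun _ => rfl
  exact ((natEq.comp (hcount.pair ((codeFP_fieldU 1).comp hy))).and hall).congr fun _ => rfl

/-! ### The evaluation: level strings, RM3 values, tribes -/

/-- The level string of the RM3 instance `t` is polynomial time (context `(u, y)`, item `t`). -/
theorem codeFP_levStr : CodeFP (pairE E natE) strE (fun q => levStr q.1.1 q.1.2 q.2) := by
  have hε : CodeFP (pairE E natE) E Prod.fst := fst _ _
  have ht : CodeFP (pairE E natE) natE Prod.snd := snd _ _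
  have hy : CodeFP (pairE E natE) strE (fun q => q.1.2) := hε.snd'
  have huL : CodeFP (pairE E natE) unE (fun q => q.1.1.length) := strLength.comp hε.fst'
  have h3d : CodeFP (pairE E natE) natE (fun q => 3 ^ pD q.1.2) := (codeFP_pow3.comp hy).congr fun _ => by rfl
  have hrange : CodeFP (pairE E natE) (rawE natE) (fun q => List.range (min (3 ^ pD q.1.2) q.1.1.length)) :=
    urange.comp (unOfNatMin.comp (huL.pair h3d))
  -- the item map: context `((u,y),t)`, item `s` ↦ block bit of block `s + 3^d·t`
  have hidx : CodeFP (pairE (pairE E natE) natE) natE (fun r => r.2 + 3 ^ pD r.1.1.2 * r.1.2) :=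
    (natAdd.comp ((snd _ _).pair (natMul.comp ((h3d.comp (fst _ _)).pair (ht.comp (fst _ _)))))).congr
      fun _ => by rfl
  have hbit : CodeFP (pairE (pairE E natE) natE) bitE
      (fun r => blockBit r.1.1.1 (pT r.1.1.2) (pN r.1.1.2) (pK r.1.1.2) (r.2 + 3 ^ pD r.1.1.2 * r.1.2)) :=
    (codeFP_blockBit'.comp ((hε.comp (fst _ _)).pair hidx)).congr fun _ => by rfl
  exact (bitsToStr.comp ((map hbit).comp ((CodeFP.id _).pair hrange))).congr fun _ => by rfl

/-- The level string has at most `|u|` bits. -/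
theorem length_levStr_le (u y : List Bool) (t : ℕ) : (levStr u y t).length ≤ u.length := by
  simp only [levStr, List.length_map, List.length_range]
  exact min_le_right _ _

/-- The RM3 value of instance `t` is polynomial time (the accumulator of the rounds only shrinks). -/
theorem codeFP_rmVal : CodeFP (pairE E natE) bitE (fun q => rmVal q.1.1 q.1.2 q.2) := by
  have hstep : CodeFP (pairE (pairE E natE) (pairE unitE strE)) strE (fun t => round t.2.2) :=
    codeFP_round.comp (snd _ _).snd'
  have h := foldl (σ := (List Bool × List Bool) × ℕ) (α := Unit) (eσ := pairE E natE) (eα := unitE)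
    (eβ := strE) (step := fun _ _ s => round s) (init := fun q => levStr q.1.1 q.1.2 q.2)
    hstep codeFP_levStr X (fun q l₁ l₂ => by
      rw [eval_X]
      refine (length_foldl_round_le l₁ _).trans ((length_levStr_le _ _ _).trans ?_)
      simp only [pairE_apply, length_boolPair]
      have h2 : (strE q.1.1).length = q.1.1.length := rfl
      omega)
  have hdU : CodeFP (pairE E natE) unE (fun q => pD q.1.2) := (codeFP_fieldUu 8).comp (fst _ _).snd'
  exact (strGetDNat.comp ((h.comp ((CodeFP.id _).pair (replicateUnit.comp hdU))).pair (const _ 0))).congr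
    fun _ => by rfl

/-- `tribesVal` is polynomial time. -/
theorem codeFP_tribesVal : CodeFP E bitE (fun p => tribesVal p.1 p.2) := by
  -- inner `all` over `i`, context `((u,y), j)`
  have hin : CodeFP (pairE (pairE E natE) natE) bitE
      (fun r => rmVal r.1.1.1 r.1.1.2 (r.2 + pW r.1.1.2 * r.1.2)) :=
    (codeFP_rmVal.comp (((fst _ _).fst').pair (natAdd.comp ((snd _ _).pair (natMul.comp
      (((codeFP_fieldU 6).comp ((fst _ _).fst'.snd')).pair ((fst _ _).snd'))))))).congr fun _ => by rfl
  have hWu : CodeFP (pairE E natE) unE (fun q => pW q.1.2) := (codeFP_fieldUu 6).comp (fst _ _).snd'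
  have hall : CodeFP (pairE E natE) bitE
      (fun q => (List.range (pW q.1.2)).all fun i => rmVal q.1.1 q.1.2 (i + pW q.1.2 * q.2)) :=
    ((all hin).comp ((CodeFP.id _).pair (urange.comp hWu))).congr fun _ => by rfl
  have hMu : CodeFP E unE (fun p => pM p.2) := (codeFP_fieldUu 7).comp (snd _ _)
  exact ((any hall).comp ((CodeFP.id _).pair (urange.comp hMu))).congr fun _ => by rfl

/-- **The verdict is polynomial time on codes.** -/
theorem codeFP_verdict : CodeFP E bitE verdict :=
  (codeFP_checks.and codeFP_tribesVal).congr fun _ => rfl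

/-! ### The language and its membership in `NP` -/

/-- **The `TRIBES ∘ RM3 ∘ CLIQUE` language**: inputs with an accepted certificate of length `≤ 20|u| + 20`. -/
def halfLang : Language Bool :=
  {u | ∃ y : List Bool, y.length ≤ (20 * X + 20 : Polynomial ℕ).eval u.length ∧ verdict (u, y) = true}

/-- Membership, unfolded. -/
theorem mem_halfLang {u : List Bool} :
    u ∈ halfLang ↔ ∃ y : List Bool, y.length ≤ 20 * u.length + 20 ∧ verdict (u, y) = true := by
  change (∃ y : List Bool, y.length ≤ (20 * X + 20 : Polynomial ℕ).eval u.length ∧ verdict (u, y) = true) ↔ _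
  simp

/-- **`halfLang ∈ NP`** (certificate definition, verifier `verdict ∈ FP`). -/
theorem halfLang_mem_NP : halfLang ∈ Nondeterministic.NP := by
  obtain ⟨f, hf, hfv⟩ := codeFP_verdict
  refine mem_NP_iff_verifier.2 ⟨{z | f z = [true]}, setOf_apply_eq_apply_mem_P hf (const_mem_FP [true]),
    20 * X + 20, fun u => ?_⟩
  refine exists_congr fun y => and_congr Iff.rfl ?_
  change verdict (u, y) = true ↔ f (boolPair u y) = [true]
  rw [show boolPair u y = E (u, y) from rfl, hfv]
  simp [bitE]

end Summit.PneNP.PneNP.Theorems.NegLimitedHalfWindow.HalfSlices
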